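/-
Copyright (c) 2026. All rights reserved.
Released under Apache 2.0 license as described in the file LICENSE.
-/
import Mathlib
import HarnessLib

/-!
# Existence of nonzero points near a simple zero

This file proves that near a simple zero of an analytic function, there exist points
where the function is nonzero. This is used in the limit argument for G decomposition.

## Main results

* `exists_nonzero_near_simple_zero`: Near a simple zero c of f, there exist points z ≠ c
  arbitrarily close to c with f(z) ≠ 0.
-/

open Complex Real Set Filter Topology Metric
open scoped BigOperators Topology ComplexConjugate

noncomputable section

namespace EarlyAppointmentsExistsNonzero

/-- Near c, there are points with f(z) ≠ 0, where f has a simple zero at c.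

This follows from: f(z) = (z - c) * dslope f c z, where dslope f c c = deriv f c ≠ 0.
By continuity of dslope, for z ≠ c near c, dslope f c z ≠ 0, hence f(z) ≠ 0. -/
theorem exists_nonzero_near_simple_zero {f : ℂ → ℂ} {c : ℂ}
    (hf_diff : Differentiable ℂ f)
    (hz₀ : f c = 0)
    (hz₀_simple : deriv f c ≠ 0) :
    ∀ ε > 0, ∃ z : ℂ, z ≠ c ∧ ‖z - c‖ < ε ∧ f z ≠ 0 := by
  intro ε hε
  -- f has a simple zero at c, so f(z) = (z - c) * g(z) where g(c) = deriv f c ≠ 0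
  have hg_ne : dslope f c c ≠ 0 := by simp only [dslope_same]; exact hz₀_simple
  have hg_cont : ContinuousAt (dslope f c) c := by
    have hdiff : DifferentiableOn ℂ (dslope f c) Set.univ :=
      (Complex.differentiableOn_dslope (isOpen_univ.mem_nhds (Set.mem_univ c))).mpr
        hf_diff.differentiableOn
    exact (hdiff c (Set.mem_univ c)).differentiableAt (isOpen_univ.mem_nhds (Set.mem_univ c))
      |>.continuousAt
  -- g(c) ≠ 0 and g continuous ⟹ g ≠ 0 in a neighborhood of c
  obtain ⟨δ, hδ_pos, hg_nonzero⟩ := Metric.continuousAt_iff.mp hg_cont (‖dslope f c c‖ / 2) (by positivity)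
  -- Pick z ≠ c with ‖z - c‖ < min(ε, δ)
  let r := min ε δ / 2
  have hr_pos : 0 < r := by positivity
  let z := c + (r : ℂ)
  use z
  have hz_sub : z - c = (r : ℂ) := by ring
  have hz_norm : ‖z - c‖ = r := by
    rw [hz_sub, Complex.norm_real]
    exact abs_of_pos hr_pos
  have hz_ne_c : z ≠ c := by
    intro heq
    rw [← sub_eq_zero, hz_sub] at heq
    exact (ne_of_gt hr_pos) (Complex.ofReal_eq_zero.mp heq)
  have hr_lt_min : r < min ε δ := by
    have h1 : min ε δ > 0 := lt_min hε hδ_pos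
    calc r = min ε δ / 2 := rfl
      _ < min ε δ := by linarith
  refine ⟨hz_ne_c, ?_, ?_⟩
  · -- ‖z - c‖ < ε
    rw [hz_norm]
    exact lt_of_lt_of_le hr_lt_min (min_le_left ε δ)
  · -- f(z) ≠ 0
    have hz_dist : dist z c < δ := by
      rw [dist_eq_norm, hz_norm]
      exact lt_of_lt_of_le hr_lt_min (min_le_right ε δ)
    have hg_z : dist (dslope f c z) (dslope f c c) < ‖dslope f c c‖ / 2 := hg_nonzero hz_dist
    have hg_z_ne : dslope f c z ≠ 0 := by
      intro h
      rw [h, dist_zero_left] at hg_z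
      linarith [norm_nonneg (dslope f c c)]
    -- f(z) = f(z) - f(c) = (z - c) * dslope f c z ≠ 0 (since z ≠ c and dslope ≠ 0)
    have hf_factor := sub_smul_dslope f c z
    rw [smul_eq_mul, hz₀, sub_zero] at hf_factor
    rw [← hf_factor]
    exact mul_ne_zero (sub_ne_zero.mpr hz_ne_c) hg_z_ne

end EarlyAppointmentsExistsNonzero

end
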